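import Mathlib.Analysis.SpecialFunctions.Pow.Real
import Mathlib.Analysis.SpecialFunctions.Log.Basic
import HarnessLib

/-!
# The counting exponent on the Siegel cone: `∏_{i<j} max(1, (aᵢaⱼ)⁻¹) · ∏ᵢ max(1, aᵢ⁻¹)` against
# the modulus `∏_{i<j} aᵢ/aⱼ`

Topic `NumberTheory/Automorphic`; namespace `Literature.NumberTheory.Automorphic`. Proof file (theorems
only, no definitions, no named facts). It supplies the one real inequality behind the finiteness of the
volume of `U(H)(L⁺)\U(H)(𝔸_{L⁺})` for a unitary group `U(H) ≤ GL_N` over a CM field `L` by the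
orbit-count unfolding against the reduction theory of `GL_N(𝔸_L)` (Borel–Harish-Chandra finiteness,
Borel (1963), Thm. 5.8, in the style of Siegel–Weil unfolding): on a Siegel set of `GL_N(𝔸_L)` with
torus parameter `a = (a₀ ≥ t a₁ ≥ …)`, `∏ aᵢ = 1`, the number of rational HERMITIAN matrices `h` with
`a h a` in a fixed compact set is `≪ ∏_{i<j} max(1, (aᵢaⱼ)⁻¹)^{[L:ℚ]} · ∏ᵢ max(1, aᵢ⁻¹)^{[L:ℚ]}`
(diagonal entries lie in `L⁺`, `[L⁺:ℚ] = [L:ℚ]/2`, and `max(1, aᵢ⁻²)^{1/2} = max(1, aᵢ⁻¹)`), while the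
Haar measure of the corresponding piece of the Siegel set is `≪ (∏_{i<j} aᵢ/aⱼ)^{-[L:ℚ]}`. The present
file proves that the count is at most a constant times the `(1 - 1/N)`-th power of the modulus, so that
count × measure decays like the `(-1/N)`-th power of the modulus, a convergent multiple geometric series
over the dyadic decomposition of the cone.

In logarithmic coordinates `wᵢ = log aᵢ` (`∑ wᵢ = 0`) the statements are, with
`S(w) = ∑ᵢ max(0, wᵢ)`, `E(w) = ∑ᵢ max(0, -wᵢ) + ∑_{i<j} max(0, -wᵢ - wⱼ)` (the counting exponent)
and `R(w) = ∑_{i<j} (wᵢ - wⱼ)` (the logarithm of the modulus):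

* `sum_posPart_eq_sum_negPart` — `∑ wᵢ = 0 ⇒ ∑ max(0, wᵢ) = ∑ max(0, -wᵢ)`;
* `coneCountExponent_le` — **`E(w) ≤ (N - 1) · S(w)`** whenever `∑ wᵢ = 0` (no ordering needed): the
  pointwise inequality `max(0,-x-y) ≤ max(0,-x) + max(0,-y) - min(max(0,x), max(0,-y)) -
  min(max(0,y), max(0,-x))` summed over all ordered pairs, and `∑_{i,j} min(max(0,wᵢ), max(0,-wⱼ)) ≥ S(w)`
  (`sum_min_le_min_sum` twice);
* `card_mul_posSum_le_rootSum` — **`N · S(w) ≤ R(w)`** for `w` non-increasing with `∑ wᵢ = 0`: the pairs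
  `(i, j)` with `wᵢ ≥ 0 > wⱼ` alone contribute `N · S(w)`;
* `coneCountExponent_le_rootSum` — with slack: if `∑ wᵢ = 0` and `wⱼ ≤ wᵢ + κ` for all `i < j`
  (`κ ≥ 0`), then `E(w) ≤ (N-1)/N · R(w) + c_N κ` (perturb to a sorted `w'`, `exists_sorted_perturbation`);
* `prod_max_inv_le_mul_prod_root_rpow` — the multiplicative form consumed by the Siegel-set
  integration: for `aᵢ > 0` with `∏ aᵢ = 1` and `aⱼ ≤ M aᵢ` (`i < j`, `M ≥ 1`),
  `(∏_{i<j} max(1, (aᵢaⱼ)⁻¹)) · ∏ᵢ max(1, aᵢ⁻¹) ≤ M^{c_N} · (∏_{i<j} aᵢ/aⱼ)^{(N-1)/N}`.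

Elementary real analysis; no source is followed (the classical treatments — Borel (1969), §§ 12–16,
Godement, Sém. Bourbaki 257, § 8 — integrate the modulus itself over the cone; the `1 - 1/N` margin is
what the hermitian lattice count leaves).

## References

* A. Borel, *Some finiteness properties of adele groups over number fields*, Publ. Math. IHÉS 16
  (1963), § 5, Thm. 5.8 [Borel1963].
* R. Godement, *Domaines fondamentaux des groupes arithmétiques*, Sém. Bourbaki 257 (1962/63), § 8
  [Godement1964].
-/

noncomputable section

open Finset Real

namespace Literature.NumberTheory.Automorphic

/-! ### Pointwise inequalities -/

section Pointwise

/-- `max(0, x) - max(0, -x) = x`. [folklore] -/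
private theorem max_zero_sub_max_zero_neg (x : ℝ) : max 0 x - max 0 (-x) = x := by
  rcases le_total 0 x with hx | hx
  · rw [max_eq_right hx, max_eq_left (neg_nonpos.2 hx)]; ring
  · rw [max_eq_left hx, max_eq_right (neg_nonneg.2 hx)]; ring

/-- The pointwise inequality behind `E(w) ≤ (N-1) S(w)`: for real `x, y`,
`max(0, -x-y) ≤ max(0,-x) + max(0,-y) - min(max(0,x), max(0,-y)) - min(max(0,y), max(0,-x))` (in fact
an identity; checked by cases on the signs of `x`, `y`). [folklore] -/
private theorem max_zero_neg_add_le (x y : ℝ) :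
    max 0 (-x - y) ≤ max 0 (-x) + max 0 (-y) - min (max 0 x) (max 0 (-y)) - min (max 0 y) (max 0 (-x)) := by
  rcases le_total 0 x with hx | hx <;> rcases le_total 0 y with hy | hy
  · -- `x, y ≥ 0`
    rw [max_eq_right hx, max_eq_right hy, max_eq_left (neg_nonpos.2 hx), max_eq_left (neg_nonpos.2 hy),
      max_eq_left (by linarith : -x - y ≤ 0), min_eq_right hx, min_eq_right hy]
    linarith
  · -- `x ≥ 0 ≥ y`
    rw [max_eq_right hx, max_eq_left hy, max_eq_left (neg_nonpos.2 hx), max_eq_right (neg_nonneg.2 hy),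
      min_eq_left (le_refl (0:ℝ))]
    rcases le_total x (-y) with h | h
    · rw [min_eq_left h, max_eq_right (by linarith : (0:ℝ) ≤ -x - y)]; linarith
    · rw [min_eq_right h, max_eq_left (by linarith : -x - y ≤ 0)]; linarith
  · -- `x ≤ 0 ≤ y`
    rw [max_eq_left hx, max_eq_right hy, max_eq_right (neg_nonneg.2 hx), max_eq_left (neg_nonpos.2 hy),
      min_eq_left (le_refl (0:ℝ))]
    rcases le_total y (-x) with h | h
    · rw [min_eq_left h, max_eq_right (by linarith : (0:ℝ) ≤ -x - y)]; linarith
    · rw [min_eq_right h, max_eq_left (by linarith : -x - y ≤ 0)]; linarith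
  · -- `x, y ≤ 0`
    rw [max_eq_left hx, max_eq_left hy, max_eq_right (neg_nonneg.2 hx), max_eq_right (neg_nonneg.2 hy),
      max_eq_right (by linarith : (0:ℝ) ≤ -x - y), min_eq_left (neg_nonneg.2 hy), min_eq_left (neg_nonneg.2 hx)]
    linarith

/-- The pointwise inequality behind `N S(w) ≤ R(w)`: with the indicators `χ⁺(x) = [0 ≤ x]`,
`χ⁻(x) = [x < 0]`, one has `χ⁺(x) χ⁻(y) (x - y) + χ⁻(x) χ⁺(y) (y - x) ≤ |x - y|`. [folklore] -/
private theorem indicator_mul_sub_le_abs (x y : ℝ) :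
    (if 0 ≤ x then (1:ℝ) else 0) * (if y < 0 then (1:ℝ) else 0) * (x - y) +
      (if x < 0 then (1:ℝ) else 0) * (if 0 ≤ y then (1:ℝ) else 0) * (y - x) ≤ |x - y| := by
  by_cases hx : 0 ≤ x <;> by_cases hy : 0 ≤ y
  · rw [if_pos hx, if_neg (not_lt.2 hy), if_neg (not_lt.2 hx), if_pos hy]; simp
  · rw [if_pos hx, if_pos (not_le.1 hy), if_neg (not_lt.2 hx), if_neg hy]
    simp only [mul_one, one_mul, zero_mul, add_zero]
    exact le_abs_self _
  · rw [if_neg hx, if_pos (not_le.1 hx), if_pos hy, if_neg (not_lt.2 hy)]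
    simp only [zero_mul, zero_add, one_mul]
    rw [abs_sub_comm]; exact le_abs_self _
  · rw [if_neg hx, if_neg hy]; simp

/-- `min(c, u) + min(c, v) ≥ min(c, u + v)` for `c, u, v ≥ 0`. [folklore] -/
private theorem min_add_le_min_add_min {c u v : ℝ} (hc : 0 ≤ c) (hu : 0 ≤ u) (hv : 0 ≤ v) :
    min c (u + v) ≤ min c u + min c v := by
  rcases le_total c u with h1 | h1
  · rw [min_eq_left h1]
    exact (min_le_left _ _).trans (by linarith [le_min hc hv] : c ≤ c + min c v)
  · rw [min_eq_right h1]
    rcases le_total c v with h2 | h2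
    · rw [min_eq_left h2]; exact (min_le_left _ _).trans (by linarith)
    · rw [min_eq_right h2]; exact min_le_right _ _

/-- `∑_{j ∈ s} min(c, xⱼ) ≥ min(c, ∑_{j ∈ s} xⱼ)` for `c ≥ 0` and `xⱼ ≥ 0`. [folklore] -/
private theorem min_sum_le_sum_min {ι : Type*} (s : Finset ι) {c : ℝ} (hc : 0 ≤ c) {x : ι → ℝ}
    (hx : ∀ j ∈ s, 0 ≤ x j) : min c (∑ j ∈ s, x j) ≤ ∑ j ∈ s, min c (x j) := by
  classical
  induction s using Finset.induction_on with
  | empty => simp [hc]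
  | @insert a s ha ih =>
    rw [Finset.sum_insert ha, Finset.sum_insert ha]
    have hxa : 0 ≤ x a := hx a (Finset.mem_insert_self a s)
    have hxs : ∀ j ∈ s, 0 ≤ x j := fun j hj => hx j (Finset.mem_insert_of_mem hj)
    exact (min_add_le_min_add_min hc hxa (Finset.sum_nonneg hxs)).trans (by linarith [ih hxs])

end Pointwise

/-! ### The counting exponent against the positive sum: `E(w) ≤ (N - 1) S(w)` -/

section Sums

variable {N : ℕ}

/-- `∑ wᵢ = 0 ⇒ ∑ max(0, wᵢ) = ∑ max(0, -wᵢ)` (the positive and negative parts have the same total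
mass). [folklore] -/
private theorem sum_posPart_eq_sum_negPart {w : Fin N → ℝ} (hw : ∑ i, w i = 0) :
    ∑ i, max 0 (w i) = ∑ i, max 0 (-w i) := by
  have h : ∑ i, (max 0 (w i) - max 0 (-w i)) = 0 := by
    simp_rw [max_zero_sub_max_zero_neg]; exact hw
  rw [Finset.sum_sub_distrib] at h
  linarith

/-- A sum over ordered pairs `i < j` of a symmetric function is half the sum over all pairs `i ≠ j`:
`2 ∑_{i<j} f i j = ∑_{i,j} f i j - ∑ᵢ f i i`. [folklore] -/
private theorem two_mul_sum_sum_ite_lt_eq {f : Fin N → Fin N → ℝ} (hf : ∀ i j, f i j = f j i) :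
    2 * ∑ i, ∑ j, (if i < j then f i j else 0) = (∑ i, ∑ j, f i j) - ∑ i, f i i := by
  have hswap : ∑ i, ∑ j, (if i < j then f i j else 0) = ∑ i, ∑ j, (if j < i then f i j else 0) := by
    rw [Finset.sum_comm]
    refine Finset.sum_congr rfl fun i _ => Finset.sum_congr rfl fun j _ => ?_
    split_ifs <;> first | rfl | exact hf j i
  have hsplit : ∀ i j : Fin N, f i j =
      (if i < j then f i j else 0) + (if j < i then f i j else 0) + (if i = j then f i j else 0) := by
    intro i j
    rcases lt_trichotomy i j with h | h | h
    · rw [if_pos h, if_neg (not_lt.2 h.le), if_neg h.ne]; ring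
    · subst h; simp
    · rw [if_neg (not_lt.2 h.le), if_pos h, if_neg h.ne']; ring
  have hall : ∑ i, ∑ j, f i j = ∑ i, ∑ j, (if i < j then f i j else 0) +
      ∑ i, ∑ j, (if j < i then f i j else 0) + ∑ i, f i i := by
    conv_lhs => arg 2; ext i; arg 2; ext j; rw [hsplit i j]
    simp only [Finset.sum_add_distrib, Finset.sum_ite_eq, Finset.mem_univ, if_true]
  rw [hall, ← hswap]
  ring

/-- **The counting exponent is at most `(N-1)` times the positive sum.** For `w : Fin N → ℝ` with
`∑ wᵢ = 0`,
`∑ᵢ max(0, -wᵢ) + ∑_{i<j} max(0, -wᵢ - wⱼ) ≤ (N - 1) · ∑ᵢ max(0, wᵢ)`.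
No ordering of the `wᵢ` is needed. Elementary step of the finiteness of the volume of the Siegel set
weighted by the hermitian lattice count (our route to Borel (1963), Thm. 5.8 for unitary groups).
[cite: Borel1963, Thm. 5.8] -/
theorem coneCountExponent_le {w : Fin N → ℝ} (hw : ∑ i, w i = 0) :
    (∑ i, max 0 (-w i)) + ∑ i, ∑ j, (if i < j then max 0 (-w i - w j) else 0) ≤
      ((N : ℝ) - 1) * ∑ i, max 0 (w i) := by
  set S := ∑ i, max 0 (w i) with hS
  have hS' : ∑ i, max 0 (-w i) = S := (sum_posPart_eq_sum_negPart hw).symm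
  have hSnn : 0 ≤ S := Finset.sum_nonneg fun i _ => le_max_left _ _
  -- the symmetric pair function and its diagonal
  set f : Fin N → Fin N → ℝ := fun i j => max 0 (-w i - w j) with hf
  have hfs : ∀ i j, f i j = f j i := fun i j => by simp only [hf]; ring_nf
  have hdiag : ∑ i, f i i = 2 * S := by
    rw [← hS', Finset.mul_sum]
    refine Finset.sum_congr rfl fun i _ => ?_
    simp only [hf]
    rcases le_total 0 (w i) with h | h
    · rw [max_eq_left (by linarith : -w i - w i ≤ 0), max_eq_left (by linarith : -w i ≤ 0)]; ring
    · rw [max_eq_right (by linarith : 0 ≤ -w i - w i), max_eq_right (by linarith : 0 ≤ -w i)]; ring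
  -- the sum over all ordered pairs
  have hmin : S ≤ ∑ i, ∑ j, min (max 0 (w i)) (max 0 (-w j)) := by
    have h1 : ∀ i, min (max 0 (w i)) S ≤ ∑ j, min (max 0 (w i)) (max 0 (-w j)) := by
      intro i
      rw [← hS']
      exact min_sum_le_sum_min _ (le_max_left _ _) fun j _ => le_max_left _ _
    have h2 : min S S ≤ ∑ i, min S (max 0 (w i)) :=
      min_sum_le_sum_min _ hSnn fun i _ => le_max_left _ _
    rw [min_self] at h2
    calc S ≤ ∑ i, min S (max 0 (w i)) := h2
      _ = ∑ i, min (max 0 (w i)) S := Finset.sum_congr rfl fun i _ => min_comm _ _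
      _ ≤ _ := Finset.sum_le_sum fun i _ => h1 i
  have hmin' : ∑ i, ∑ j, min (max 0 (w j)) (max 0 (-w i)) = ∑ i, ∑ j, min (max 0 (w i)) (max 0 (-w j)) :=
    Finset.sum_comm
  have hall : ∑ i, ∑ j, f i j ≤ 2 * (N : ℝ) * S - 2 * S := by
    calc ∑ i, ∑ j, f i j
        ≤ ∑ i, ∑ j, (max 0 (-w i) + max 0 (-w j) - min (max 0 (w i)) (max 0 (-w j)) -
            min (max 0 (w j)) (max 0 (-w i))) :=
          Finset.sum_le_sum fun i _ => Finset.sum_le_sum fun j _ => max_zero_neg_add_le (w i) (w j)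
      _ = (N : ℝ) * S + (N : ℝ) * S - ∑ i, ∑ j, min (max 0 (w i)) (max 0 (-w j)) -
            ∑ i, ∑ j, min (max 0 (w j)) (max 0 (-w i)) := by
          have hA : ∑ i : Fin N, ∑ _j : Fin N, max 0 (-w i) = (N : ℝ) * S := by
            simp only [Finset.sum_const, Finset.card_univ, Fintype.card_fin, nsmul_eq_mul]
            rw [← Finset.mul_sum, hS']
          have hB : ∑ _i : Fin N, ∑ j : Fin N, max 0 (-w j) = (N : ℝ) * S := by
            rw [hS', Finset.sum_const, Finset.card_univ, Fintype.card_fin, nsmul_eq_mul]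
          simp only [Finset.sum_sub_distrib, Finset.sum_add_distrib]
          rw [hA, hB]
      _ ≤ 2 * (N : ℝ) * S - 2 * S := by rw [hmin']; linarith
  have hpairs := two_mul_sum_sum_ite_lt_eq hfs
  rw [hdiag] at hpairs
  -- conclude
  have : ∑ i, ∑ j, (if i < j then f i j else 0) ≤ ((N : ℝ) - 2) * S := by linarith
  rw [hS']
  calc S + ∑ i, ∑ j, (if i < j then max 0 (-w i - w j) else 0) = S + ∑ i, ∑ j, (if i < j then f i j else 0) := rfl
    _ ≤ S + ((N : ℝ) - 2) * S := by linarith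
    _ = ((N : ℝ) - 1) * S := by ring

/-! ### The modulus exponent against the positive sum: `N S(w) ≤ R(w)` for sorted `w` -/

/-- **`N · S(w) ≤ R(w)` for non-increasing `w` with `∑ wᵢ = 0`**:
`N · ∑ᵢ max(0, wᵢ) ≤ ∑_{i<j} (wᵢ - wⱼ)`. The pairs `(i, j)` with `wᵢ ≥ 0 > wⱼ` (necessarily `i < j`)
contribute `#{w < 0} · S + #{w ≥ 0} · S = N S`, the other pairs are non-negative. Elementary step of
our route to Borel (1963), Thm. 5.8 for unitary groups. [cite: Borel1963, Thm. 5.8] -/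
theorem card_mul_posSum_le_rootSum {w : Fin N → ℝ} (hw : ∑ i, w i = 0)
    (hmono : ∀ i j : Fin N, i < j → w j ≤ w i) :
    (N : ℝ) * ∑ i, max 0 (w i) ≤ ∑ i, ∑ j, (if i < j then (w i - w j) else 0) := by
  set S := ∑ i, max 0 (w i) with hS
  have hS' : ∑ i, max 0 (-w i) = S := (sum_posPart_eq_sum_negPart hw).symm
  -- indicators
  set cp : Fin N → ℝ := fun i => if 0 ≤ w i then 1 else 0 with hcp
  set cm : Fin N → ℝ := fun i => if w i < 0 then 1 else 0 with hcm
  have hcpm : ∀ i, cp i + cm i = 1 := fun i => by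
    simp only [hcp, hcm]; by_cases h : 0 ≤ w i
    · rw [if_pos h, if_neg (not_lt.2 h)]; ring
    · rw [if_neg h, if_pos (not_le.1 h)]; ring
  have hcpw : ∀ i, cp i * w i = max 0 (w i) := fun i => by
    simp only [hcp]; by_cases h : 0 ≤ w i
    · rw [if_pos h, max_eq_right h, one_mul]
    · rw [if_neg h, max_eq_left (not_le.1 h).le, zero_mul]
  have hcmw : ∀ i, cm i * w i = -max 0 (-w i) := fun i => by
    simp only [hcm]; by_cases h : w i < 0
    · rw [if_pos h, max_eq_right (by linarith : 0 ≤ -w i)]; ring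
    · rw [if_neg h, max_eq_left (by linarith : -w i ≤ 0)]; ring
  set p := ∑ i, cp i with hp
  set q := ∑ i, cm i with hq
  have hpq : p + q = N := by
    rw [hp, hq, ← Finset.sum_add_distrib]
    simp [hcpm]
  -- `|wᵢ - wⱼ|` summed over all pairs is twice the root sum (sortedness)
  have habs : ∑ i, ∑ j, |w i - w j| = 2 * ∑ i, ∑ j, (if i < j then (w i - w j) else 0) := by
    have hsym : ∀ i j : Fin N, |w i - w j| = |w j - w i| := fun i j => abs_sub_comm _ _
    have h1 := two_mul_sum_sum_ite_lt_eq hsym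
    simp only [sub_self, abs_zero, Finset.sum_const_zero, sub_zero] at h1
    have h2 : ∑ i, ∑ j, (if i < j then |w i - w j| else 0) = ∑ i, ∑ j, (if i < j then (w i - w j) else 0) := by
      refine Finset.sum_congr rfl fun i _ => Finset.sum_congr rfl fun j _ => ?_
      split_ifs with h
      · rw [abs_of_nonneg (by linarith [hmono i j h])]
      · rfl
    rw [← h2, h1]
  -- the indicator lower bound, summed
  have hind : ∑ i, ∑ j, (cp i * cm j * (w i - w j) + cm i * cp j * (w j - w i)) ≤ ∑ i, ∑ j, |w i - w j| :=
    Finset.sum_le_sum fun i _ => Finset.sum_le_sum fun j _ => indicator_mul_sub_le_abs (w i) (w j)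
  have hblock : ∑ i, ∑ j, cp i * cm j * (w i - w j) = (N : ℝ) * S := by
    have : ∀ i j, cp i * cm j * (w i - w j) = (cp i * w i) * cm j - cp i * (cm j * w j) := fun i j => by ring
    simp_rw [this, Finset.sum_sub_distrib, ← Finset.mul_sum, ← Finset.sum_mul, hcpw, hcmw]
    rw [Finset.sum_neg_distrib, hS', ← hq, ← hp, ← hS, ← hpq]
    ring
  have hblock' : ∑ i, ∑ j, cm i * cp j * (w j - w i) = (N : ℝ) * S := by
    rw [Finset.sum_comm]
    have : ∀ i j : Fin N, cm j * cp i * (w i - w j) = cp i * cm j * (w i - w j) := fun i j => by ring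
    simp_rw [this]
    exact hblock
  have hsum : ∑ i, ∑ j, (cp i * cm j * (w i - w j) + cm i * cp j * (w j - w i)) = 2 * (N : ℝ) * S := by
    simp_rw [Finset.sum_add_distrib]
    rw [hblock, hblock']; ring
  rw [hsum, habs] at hind
  linarith

/-! ### With slack, and the multiplicative form -/

/-- Perturbation to a sorted sequence: if `wⱼ ≤ wᵢ + κ` for all `i < j` (`κ ≥ 0`), then
`w'ᵢ = wᵢ - 2κ i + m` (with `m` the mean of the `2κ i`) is non-increasing, has the same sum, and
`|w'ᵢ - wᵢ| ≤ 2 κ N`. [folklore] -/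
private theorem exists_sorted_perturbation {w : Fin N → ℝ} {κ : ℝ} (hκ : 0 ≤ κ) (hw : ∑ i, w i = 0)
    (hslack : ∀ i j : Fin N, i < j → w j ≤ w i + κ) :
    ∃ w' : Fin N → ℝ, (∑ i, w' i = 0) ∧ (∀ i j : Fin N, i < j → w' j ≤ w' i) ∧
      (∀ i : Fin N, |w' i - w i| ≤ 2 * κ * N) := by
  rcases Nat.eq_zero_or_pos N with hN | hN
  · subst hN
    exact ⟨w, hw, fun i => Fin.elim0 i, fun i => Fin.elim0 i⟩
  have hNpos : (0 : ℝ) < N := by exact_mod_cast hN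
  set m : ℝ := (∑ i : Fin N, 2 * κ * ((i : ℕ) : ℝ)) / N with hm
  have hile : ∀ i : Fin N, ((i : ℕ) : ℝ) ≤ N := fun i => by exact_mod_cast i.2.le
  have hi0 : ∀ i : Fin N, (0 : ℝ) ≤ ((i : ℕ) : ℝ) := fun i => Nat.cast_nonneg _
  have hm0 : 0 ≤ m := div_nonneg (Finset.sum_nonneg fun i _ => by nlinarith [hi0 i]) hNpos.le
  have hmle : m ≤ 2 * κ * N := by
    rw [hm, div_le_iff₀ hNpos]
    calc ∑ i : Fin N, 2 * κ * ((i : ℕ) : ℝ) ≤ ∑ _i : Fin N, 2 * κ * (N : ℝ) :=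
          Finset.sum_le_sum fun i _ => by nlinarith [hile i]
      _ = 2 * κ * N * N := by
          rw [Finset.sum_const, Finset.card_univ, Fintype.card_fin, nsmul_eq_mul]; ring
  refine ⟨fun i => w i - 2 * κ * ((i : ℕ) : ℝ) + m, ?_, ?_, ?_⟩
  · rw [Finset.sum_add_distrib, Finset.sum_sub_distrib, hw, Finset.sum_const, Finset.card_univ,
      Fintype.card_fin, nsmul_eq_mul, hm, mul_div_cancel₀ _ hNpos.ne']
    ring
  · intro i j hij
    have h1 := hslack i j hij
    have hij' : ((i : ℕ) : ℝ) + 1 ≤ ((j : ℕ) : ℝ) := by exact_mod_cast hij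
    nlinarith
  · intro i
    have e : w i - 2 * κ * ((i : ℕ) : ℝ) + m - w i = m - 2 * κ * ((i : ℕ) : ℝ) := by ring
    rw [e, abs_le]
    constructor <;> nlinarith [hile i, hi0 i]

/-- **The counting exponent against the modulus, with slack.** There is `c ≥ 0` (depending only on `N`)
such that for every `κ ≥ 0` and every `w : Fin N → ℝ` with `∑ wᵢ = 0` and `wⱼ ≤ wᵢ + κ` for `i < j`:
`∑ᵢ max(0, -wᵢ) + ∑_{i<j} max(0, -wᵢ - wⱼ) ≤ (N-1)/N · ∑_{i<j} (wᵢ - wⱼ) + c κ`. The logarithmic form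
of the comparison «hermitian lattice count ≤ modulus^{1-1/N}» on a Siegel set of `GL_N` (our route to
Borel (1963), Thm. 5.8, finite volume of `G_k\\G_A`, for unitary groups). [cite: Borel1963, Thm. 5.8] -/
theorem coneCountExponent_le_rootSum (N : ℕ) :
    ∃ c : ℝ, 0 ≤ c ∧ ∀ (κ : ℝ), 0 ≤ κ → ∀ w : Fin N → ℝ, ∑ i, w i = 0 →
      (∀ i j : Fin N, i < j → w j ≤ w i + κ) →
      (∑ i, max 0 (-w i)) + ∑ i, ∑ j, (if i < j then max 0 (-w i - w j) else 0) ≤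
        (((N : ℝ) - 1) / N) * ∑ i, ∑ j, (if i < j then (w i - w j) else 0) + c * κ := by
  refine ⟨8 * (N : ℝ) ^ 3, by positivity, fun κ hκ w hw hslack => ?_⟩
  rcases Nat.eq_zero_or_pos N with hN | hN
  · subst hN; simp
  have hNpos : (0 : ℝ) < N := by exact_mod_cast hN
  have hN1 : (1 : ℝ) ≤ N := by exact_mod_cast hN
  obtain ⟨w', hsum', hmono', hclose⟩ := exists_sorted_perturbation hκ hw hslack
  -- Step 1: `E(w) ≤ (N-1) S(w)` (no ordering needed)
  have hE := coneCountExponent_le hw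
  -- Step 2: `S(w) ≤ S(w') + N ε`
  set ε := 2 * κ * N with hε
  have hεnn : 0 ≤ ε := by positivity
  have hSS : ∑ i, max 0 (w i) ≤ ∑ i, max 0 (w' i) + N * ε := by
    have : ∀ i, max 0 (w i) ≤ max 0 (w' i) + ε := by
      intro i
      have h := hclose i
      rw [abs_le] at h
      have : w i ≤ w' i + ε := by linarith [h.1]
      exact max_le (by linarith [le_max_left 0 (w' i)]) (by linarith [le_max_right 0 (w' i)])
    calc ∑ i, max 0 (w i) ≤ ∑ i, (max 0 (w' i) + ε) := Finset.sum_le_sum fun i _ => this i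
      _ = ∑ i, max 0 (w' i) + N * ε := by
        rw [Finset.sum_add_distrib, Finset.sum_const, Finset.card_univ, Fintype.card_fin, nsmul_eq_mul]
  -- Step 3: `N S(w') ≤ R(w')` and `R(w') ≤ R(w) + 2 κ N³`
  have hR' := card_mul_posSum_le_rootSum hsum' hmono'
  have hRR : ∑ i, ∑ j, (if i < j then (w' i - w' j) else 0) ≤
      ∑ i, ∑ j, (if i < j then (w i - w j) else 0) + 2 * ε * (N : ℝ) ^ 2 := by
    have hterm : ∀ i j : Fin N, (if i < j then (w' i - w' j) else 0) ≤
        (if i < j then (w i - w j) else 0) + 2 * ε := by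
      intro i j
      split_ifs with h
      · have hi := hclose i
        have hj := hclose j
        rw [abs_le] at hi hj
        linarith [hi.2, hj.1]
      · positivity
    calc ∑ i, ∑ j, (if i < j then (w' i - w' j) else 0)
        ≤ ∑ i, ∑ j, ((if i < j then (w i - w j) else 0) + 2 * ε) :=
          Finset.sum_le_sum fun i _ => Finset.sum_le_sum fun j _ => hterm i j
      _ = ∑ i, ∑ j, (if i < j then (w i - w j) else 0) + (N : ℝ) * N * (2 * ε) := by
          simp only [Finset.sum_add_distrib, Finset.sum_const, Finset.card_univ, Fintype.card_fin,
            nsmul_eq_mul]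
          ring
      _ = _ := by ring
  -- assemble
  set R := ∑ i, ∑ j, (if i < j then (w i - w j) else 0) with hR
  set S' := ∑ i, max 0 (w' i) with hS'
  have hS'le : S' ≤ (R + 2 * ε * (N : ℝ) ^ 2) / N := by
    rw [le_div_iff₀ hNpos]; linarith
  have hN1' : (0 : ℝ) ≤ (N : ℝ) - 1 := by linarith
  have hθ1 : ((N : ℝ) - 1) / N ≤ 1 := by rw [div_le_one hNpos]; linarith
  have hθ0 : 0 ≤ ((N : ℝ) - 1) / N := div_nonneg hN1' hNpos.le
  calc (∑ i, max 0 (-w i)) + ∑ i, ∑ j, (if i < j then max 0 (-w i - w j) else 0)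
      ≤ ((N : ℝ) - 1) * ∑ i, max 0 (w i) := hE
    _ ≤ ((N : ℝ) - 1) * (S' + N * ε) := mul_le_mul_of_nonneg_left hSS hN1'
    _ ≤ ((N : ℝ) - 1) * ((R + 2 * ε * (N : ℝ) ^ 2) / N + N * ε) := by
        gcongr
    _ = (((N : ℝ) - 1) / N) * R +
          ((((N : ℝ) - 1) / N) * (4 * (N : ℝ) ^ 3) + ((N : ℝ) - 1) * (2 * (N : ℝ) ^ 2)) * κ := by
        simp only [hε]; field_simp; ring
    _ ≤ (((N : ℝ) - 1) / N) * R + (8 * (N : ℝ) ^ 3) * κ := by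
        gcongr
        nlinarith [pow_nonneg hNpos.le 2, pow_nonneg hNpos.le 3, hN1,
          mul_le_of_le_one_left (by positivity : (0:ℝ) ≤ 4 * (N : ℝ) ^ 3) hθ1]

/-- **Multiplicative form on the Siegel cone.** There is `c ≥ 0` (depending only on `N`) such that for
all `M ≥ 1` and all `a : Fin N → ℝ` with `aᵢ > 0`, `∏ aᵢ = 1` and `aⱼ ≤ M aᵢ` for `i < j`:
`(∏_{i<j} max(1, (aᵢ aⱼ)⁻¹)) · ∏ᵢ max(1, aᵢ⁻¹) ≤ M ^ c · (∏_{i<j} aᵢ/aⱼ) ^ ((N-1)/N)`.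
On the Siegel cone `t aᵢ₊₁ ≤ aᵢ` of `GL_N` one may take `M = max(1, t⁻¹)^N`
(`siegelRoot_div_le_max_pow` of `ReductionTheoryGLnConjugation`). This is the estimate that makes the
Siegel-set integral of the hermitian lattice count a convergent multiple geometric series (the
`U(H)` case of Borel (1963), Thm. 5.8, by unfolding against `GL_N`; cf. Godement, Sém. Bourbaki 257,
§8, volume of the Siegel set as the integral of the modulus over the cone). [cite: Borel1963, Thm. 5.8] -/
theorem prod_max_inv_le_mul_prod_root_rpow (N : ℕ) :
    ∃ c : ℝ, 0 ≤ c ∧ ∀ (M : ℝ), 1 ≤ M → ∀ a : Fin N → ℝ, (∀ i, 0 < a i) → ∏ i, a i = 1 →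
      (∀ i j : Fin N, i < j → a j ≤ M * a i) →
      (∏ i, ∏ j, (if i < j then max 1 (a i * a j)⁻¹ else 1)) * ∏ i, max 1 (a i)⁻¹ ≤
        M ^ c * (∏ i, ∏ j, (if i < j then a i / a j else 1)) ^ (((N : ℝ) - 1) / N) := by
  obtain ⟨c, hc, hmain⟩ := coneCountExponent_le_rootSum N
  refine ⟨c, hc, fun M hM a ha hprod hcone => ?_⟩
  have hM0 : 0 < M := by linarith
  set w : Fin N → ℝ := fun i => Real.log (a i) with hw
  have hwsum : ∑ i, w i = 0 := by
    simp only [hw]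
    rw [← Real.log_prod (s := Finset.univ) (f := a) (fun i _ => (ha i).ne'), hprod, Real.log_one]
  have hslack : ∀ i j : Fin N, i < j → w j ≤ w i + Real.log M := by
    intro i j hij
    simp only [hw]
    rw [← Real.log_mul (ha i).ne' hM0.ne']
    exact Real.log_le_log (ha j) (by rw [mul_comm]; exact hcone i j hij)
  have key := hmain (Real.log M) (Real.log_nonneg hM) w hwsum hslack
  -- translate: the left side is `exp E(w)`, the right side `exp(c log M + θ R(w))`
  have hmax : ∀ x : ℝ, 0 < x → max 1 x⁻¹ = Real.exp (max 0 (-Real.log x)) := by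
    intro x hx
    rcases le_total 1 x with h | h
    · rw [max_eq_left (inv_le_one_of_one_le₀ h), max_eq_left (by linarith [Real.log_nonneg h]),
        Real.exp_zero]
    · rw [max_eq_right (one_le_inv₀ hx |>.2 h), max_eq_right (by linarith [Real.log_nonpos hx.le h]),
        Real.exp_neg, Real.exp_log hx]
  have hL1 : ∏ i, max 1 (a i)⁻¹ = Real.exp (∑ i, max 0 (-w i)) := by
    rw [Real.exp_sum]; exact Finset.prod_congr rfl fun i _ => hmax _ (ha i)
  have hL2 : ∏ i, ∏ j, (if i < j then max 1 (a i * a j)⁻¹ else 1) =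
      Real.exp (∑ i, ∑ j, (if i < j then max 0 (-w i - w j) else 0)) := by
    rw [Real.exp_sum]
    refine Finset.prod_congr rfl fun i _ => ?_
    rw [Real.exp_sum]
    refine Finset.prod_congr rfl fun j _ => ?_
    split_ifs with h
    · rw [hmax _ (mul_pos (ha i) (ha j))]
      simp only [hw]
      rw [Real.log_mul (ha i).ne' (ha j).ne']
      ring_nf
    · rw [Real.exp_zero]
  have hroot_pos : 0 < ∏ i, ∏ j, (if i < j then a i / a j else 1) :=
    Finset.prod_pos fun i _ => Finset.prod_pos fun j _ => by
      split_ifs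
      · exact div_pos (ha i) (ha j)
      · exact one_pos
  have hR : Real.log (∏ i, ∏ j, (if i < j then a i / a j else 1)) =
      ∑ i, ∑ j, (if i < j then (w i - w j) else 0) := by
    rw [Real.log_prod]
    · refine Finset.sum_congr rfl fun i _ => ?_
      rw [Real.log_prod]
      · refine Finset.sum_congr rfl fun j _ => ?_
        split_ifs with h
        · simp only [hw]; rw [Real.log_div (ha i).ne' (ha j).ne']
        · exact Real.log_one
      · intro j _; split_ifs
        · exact (div_pos (ha i) (ha j)).ne'
        · exact one_ne_zero
    · intro i _
      exact (Finset.prod_pos fun j _ => by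
        split_ifs
        · exact div_pos (ha i) (ha j)
        · exact one_pos).ne'
  rw [hL1, hL2, ← Real.exp_add, Real.rpow_def_of_pos hroot_pos, hR, Real.rpow_def_of_pos hM0,
    ← Real.exp_add, Real.exp_le_exp]
  linarith

end Sums

end Literature.NumberTheory.Automorphic
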